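import Mathlib
import Summits.RiemannHypothesis.RiemannHypothesis.Theorems.IntegerScrewAllBottoms
import Summits.RiemannHypothesis.RiemannHypothesis.Theorems.IntegerScrewNearExtreme
import HarnessLib

/-!
# Route `IntegerScrew` — the window law, UNIFORM over all bottoms of `Ω_R` and all cells `(p⁻, R, p)`, `p ≤ R < p²`
# (CONTINUUM-LIMIT §27.3 without side conditions)

`IntegerScrewAllBottoms.window_law_loglog` (148 ≤ Q ≤ R/2), `IntegerScrewPropKKPackaged.propKK_thin_bottom`
(K″ regime), `IntegerScrewNearExtreme.near_extreme_window_law` (299 ≤ p, 298p ≤ R) and the K″-atom law leave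
finitely-bounded corners (Q = 1; Q ≤ 147 or R < 298p outside the K″ regime, where `log R` is bounded; thin windows
R < 2Q), all covered by the trivial law `window_law_trivial_smooth` (`WF² ≤ 2(1 + (S_W/H_Q)²)·E_K·D`) with
`S_W/H_Q ≤ 13e⁵`.  Result, with `G(R) = log R + log 4 + e⁵log(R+1)(log log R + 4)`:

* **`window_law_uniform`** — for `1 ≤ Q ≤ R`, `2 ≤ R`, every `g`:
  `(Σ_{Q<x≤R} g/x − (S_W/H_Q)Σ_{b≤Q} g/b)² ≤ 2000·e²⁰·G(R)·D_{Ω_R}(g)`;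
* **`atom_window_law_uniform`** — for `2 ≤ p ≤ R < p²`, every `g`, `𝒜 = {x ≤ R : p-free}`, `W = 𝒜 ∩ (R/p, R]`:
  `(Σ_W g/x − (S_W/H_{R/p})Σ_{b≤R/p} g/b)² ≤ 2000·e²⁰·G(R)·D_𝒜(g)`.

So EVERY d = 1 cell with u < 2 and every bottom of Ω_R obeys WF² ≤ C·log R·log log R·D (κ = O((ℓ+1) log log R);
`window_law_uniform_kappa`: `H_Q·WF² ≤ 2000e²⁰(3 + 2e⁵(log log R + 4))·log R·(1 + log Q)·D`, the κ-proxy form);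
the sharper `min` with THEOREM A/B's (log R/ℓ)² is available from those theorems directly.  RH-free, elementary.
Nothing in this file bears on the truth of RH.
References: CONTINUUM-LIMIT §26–27 (rh-explicit A6-PIVOT); M. Suzuki, J. Lond. Math. Soc. (2) 108 (2023) 1448–1487
[Suzuki2023] for the screw matrices this serves.
-/

noncomputable section

set_option linter.dupNamespace false -- D-0017: `Summit.<S>.<S>.…` is the designed namespace

namespace Summit.RiemannHypothesis.RiemannHypothesis.Theorems.IntegerScrew

open Finset Real
open ArithmeticFunction (vonMangoldt)

/-! ### Small numeric facts -/

/-- `e⁶ ≥ 387`, hence `log 297 ≤ 6`. -/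
theorem log_le_six_of_le {Q : ℕ} (hQ1 : 1 ≤ Q) (hQ : Q ≤ 386) : Real.log Q ≤ 6 := by
  have hQ' : (Q : ℝ) ≤ 386 := by exact_mod_cast hQ
  have hQ0 : (0 : ℝ) < Q := by exact_mod_cast (show 0 < Q by omega)
  rw [← Real.log_exp 6]
  refine Real.log_le_log hQ0 (le_trans hQ' ?_)
  have : Real.exp 6 = Real.exp 1 ^ 6 := by rw [← Real.exp_nat_mul]; norm_num
  rw [this]
  have h27 : (2.7 : ℝ) ≤ Real.exp 1 := by have := Real.exp_one_gt_d9; linarith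
  have := pow_le_pow_left₀ (by norm_num) h27 6
  nlinarith

/-- The trivial-law coefficient: `0 ≤ c ≤ 13e⁵` gives `2(1 + c²)·(e¹⁰ G) ≤ 2000·e²⁰·G` for `G ≥ 0`. -/
theorem trivial_coef_total_le {c G : ℝ} (hc0 : 0 ≤ c) (hc : c ≤ 13 * Real.exp 5) (hG : 0 ≤ G) :
    2 * (1 + c ^ 2) * (Real.exp 10 * G) ≤ 2000 * Real.exp 20 * G := by
  have he5 := Literature.NumberTheory.LFunctions.SiegelZero.HarmFlat.hundred_le_exp_five
  have e10 : Real.exp 10 = Real.exp 5 * Real.exp 5 := by rw [← Real.exp_add]; norm_num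
  have e20 : Real.exp 20 = Real.exp 10 * Real.exp 10 := by rw [← Real.exp_add]; norm_num
  have hc2 : c ^ 2 ≤ 169 * Real.exp 10 := by
    have := pow_le_pow_left₀ hc0 hc 2
    rw [e10]; nlinarith
  have h10 : (1 : ℝ) ≤ Real.exp 10 := Real.one_le_exp (by norm_num)
  have hcoef : 2 * (1 + c ^ 2) ≤ 2000 * Real.exp 10 := by nlinarith
  rw [e20]
  have hEG : 0 ≤ Real.exp 10 * G := by positivity
  nlinarith

/-- A thin window has harmonic mass `≤ 1`: for `R ≤ 2Q`, `Σ_{Q<x≤R} 1/x ≤ 1`. -/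
theorem sum_inv_Ioc_le_one {Q R : ℕ} (hRQ : R ≤ 2 * Q) : ∑ x ∈ Ioc Q R, 1 / (x : ℝ) ≤ 1 := by
  rcases Nat.eq_zero_or_pos Q with hQ0 | hQ0
  · subst hQ0
    have : R = 0 := by omega
    subst this; simp
  have hterm : ∀ x ∈ Ioc Q R, 1 / (x : ℝ) ≤ 1 / ((Q : ℝ) + 1) := by
    intro x hx
    have hx' := (Finset.mem_Ioc.1 hx).1
    have : (Q : ℝ) + 1 ≤ x := by exact_mod_cast hx'
    exact one_div_le_one_div_of_le (by positivity) this
  refine (Finset.sum_le_sum hterm).trans ?_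
  rw [Finset.sum_const, Nat.card_Ioc, nsmul_eq_mul]
  have hRQ' : ((R - Q : ℕ) : ℝ) ≤ Q := by exact_mod_cast (show R - Q ≤ Q by omega)
  rw [mul_one_div, div_le_one (by positivity)]
  linarith

/-! ### The uniform law on `Ω_R` -/

/-- **The window law, uniform over all bottoms of `Ω_R`.**  For `1 ≤ Q ≤ R`, `2 ≤ R` and every `g`:
`(Σ_{Q<x≤R} g x/x − (S_W/H_Q)·Σ_{b≤Q} g b/b)² ≤ 2000·e²⁰·(log R + log 4 + e⁵log(R+1)(log log R + 4))·D_{Ω_R}(g)`. -/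
theorem window_law_uniform {Q R : ℕ} (hQ : 1 ≤ Q) (hQR : Q ≤ R) (hR : 2 ≤ R) (g : ℕ → ℝ) :
    (∑ x ∈ Ioc Q R, g x / x -
        (∑ x ∈ Ioc Q R, 1 / (x : ℝ)) / (∑ b ∈ Icc 1 Q, 1 / (b : ℝ)) * ∑ b ∈ Icc 1 Q, g b / b) ^ 2 ≤
      2000 * Real.exp 20 *
          (Real.log R + Real.log 4 + Real.exp 5 * Real.log ((R : ℝ) + 1) * (Real.log (Real.log R) + 4)) *
        ∑ x ∈ Icc 1 R, (1 / (x : ℝ)) * ∑ n ∈ x.divisors, (vonMangoldt n : ℝ) * (g x - g (x / n)) ^ 2 := by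
  set G := Real.log R + Real.log 4 + Real.exp 5 * Real.log ((R : ℝ) + 1) * (Real.log (Real.log R) + 4) with hG
  set D := ∑ x ∈ Icc 1 R, (1 / (x : ℝ)) * ∑ n ∈ x.divisors, (vonMangoldt n : ℝ) * (g x - g (x / n)) ^ 2 with hD
  set SW := ∑ x ∈ Ioc Q R, 1 / (x : ℝ) with hSW
  set HQ := ∑ b ∈ Icc 1 Q, 1 / (b : ℝ) with hHQ
  have hEK0 : 0 ≤ Real.exp 10 * G := EK_nonneg hR
  have hG0 : 0 ≤ G := (mul_nonneg_iff_of_pos_left (Real.exp_pos 10)).1 hEK0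
  have hD0 : 0 ≤ D := Finset.sum_nonneg fun x _ => mul_nonneg (by positivity)
    (Finset.sum_nonneg fun n _ => mul_nonneg ArithmeticFunction.vonMangoldt_nonneg (sq_nonneg _))
  have he5 := Literature.NumberTheory.LFunctions.SiegelZero.HarmFlat.hundred_le_exp_five
  -- case (a): THEOREM A ∧ K″
  by_cases hA : 148 ≤ Q ∧ 2 * Q ≤ R
  · have h := window_law_loglog hA.1 hA.2 g
    unfold exitMassRatio at h
    exact h
  -- case (b): the K″ regime
  by_cases hreg : 2 ≤ Q ∧ 2 * Real.exp 5 * Real.log Q ≤ Real.log R - Real.log Q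
  · exact propKK_thin_bottom hreg.1 hreg.2 g
  -- case (c1): Q = 1 — the window functional is the root functional
  have hSW0 : 0 ≤ SW := Finset.sum_nonneg fun x _ => by positivity
  have hSWle : SW ≤ 1 + Real.log R := by
    refine le_trans (Finset.sum_le_sum_of_subset_of_nonneg (fun x hx => ?_) fun x _ _ => by positivity)
      (harmonic_Icc_le_one_add_log (R := R) (by omega))
    have := Finset.mem_Ioc.1 hx; exact Finset.mem_Icc.2 ⟨by omega, this.2⟩
  have hHQ1 : 1 ≤ HQ := by
    have : ∑ b ∈ ({1} : Finset ℕ), 1 / (b : ℝ) ≤ HQ :=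
      Finset.sum_le_sum_of_subset_of_nonneg (by
        intro b hb; rw [Finset.mem_singleton] at hb; subst hb; exact Finset.mem_Icc.2 ⟨le_rfl, hQ⟩)
        fun b _ _ => by positivity
    simpa using this
  rcases Nat.lt_or_ge Q 2 with hQ1 | hQ2
  · have hQeq : Q = 1 := by omega
    subst hQeq
    have hW : ∑ x ∈ Ioc 1 R, g x / x - SW / HQ * ∑ b ∈ Icc 1 1, g b / b =
        ∑ x ∈ Ioc 1 R, (1 / (x : ℝ)) * (g x - g 1) := by
      have h1 : HQ = 1 := by simp [hHQ]
      rw [h1]; simp only [Finset.Icc_self, Finset.sum_singleton, Nat.cast_one, div_one]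
      rw [hSW, Finset.sum_mul, ← Finset.sum_sub_distrib]
      exact Finset.sum_congr rfl fun x _ => by ring
    rw [hW]
    have h := subset_root_functional_sq_le hR (S := Ioc 1 R) (fun x hx => by
      have := Finset.mem_Ioc.1 hx; exact Finset.mem_Icc.2 ⟨by omega, this.2⟩) g
    refine h.trans ?_
    have h10 : (1 : ℝ) ≤ Real.exp 10 := Real.one_le_exp (by norm_num)
    have e20 : Real.exp 20 = Real.exp 10 * Real.exp 10 := by rw [← Real.exp_add]; norm_num
    rw [e20]
    have : Real.exp 10 * G ≤ 2000 * (Real.exp 10 * Real.exp 10) * G := by nlinarith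
    exact mul_le_mul_of_nonneg_right this hD0
  -- case (c2): 2 ≤ Q, neither (a) nor (b): the trivial law with S_W/H_Q ≤ 13e⁵
  have htriv := window_law_trivial_smooth (N := R + 1) hQ hQR hR (by omega) g
  have hWf : (Ioc Q R).filter (· ∈ Nat.smoothNumbers (R + 1)) = Ioc Q R :=
    Finset.filter_true_of_mem fun x hx => by
      have := Finset.mem_Ioc.1 hx; exact Nat.mem_smoothNumbers_of_lt (by omega) (by omega)
  have hAf : (Icc 1 R).filter (· ∈ Nat.smoothNumbers (R + 1)) = Icc 1 R :=
    Finset.filter_true_of_mem fun x hx => by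
      have := Finset.mem_Icc.1 hx; exact Nat.mem_smoothNumbers_of_lt (by omega) (by omega)
  rw [hWf, hAf] at htriv
  refine htriv.trans ?_
  have hnreg : Real.log R - Real.log Q < 2 * Real.exp 5 * Real.log Q := by
    by_contra h; exact hreg ⟨hQ2, not_lt.1 h⟩
  -- the coefficient bound
  have hc0 : 0 ≤ SW / HQ := div_nonneg hSW0 (by linarith)
  have hc : SW / HQ ≤ 13 * Real.exp 5 := by
    rw [div_le_iff₀ (by linarith)]
    rcases Nat.lt_or_ge Q 148 with hQs | hQb
    · -- Q ≤ 147: log Q ≤ 6, so log R < (2e⁵+1)·6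
      have hlQ : Real.log Q ≤ 6 := log_le_six_of_le hQ (by omega)
      have hlQ0 : 0 ≤ Real.log Q := Real.log_natCast_nonneg Q
      nlinarith
    · -- Q ≥ 148 but R < 2Q: S_W ≤ 1
      have hR2Q : R ≤ 2 * Q := by
        by_contra h; exact hA ⟨hQb, by omega⟩
      have := sum_inv_Ioc_le_one (Q := Q) (R := R) hR2Q
      nlinarith
  have := trivial_coef_total_le hc0 hc hG0
  exact mul_le_mul_of_nonneg_right this hD0

/-! ### The uniform law on the cells `(p⁻, R, p)` -/

/-- **The window law, uniform over all near-extreme cells.**  For `2 ≤ p ≤ R < p²` and every `g`, with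
`𝒜 = {x ≤ R : x p-free}`, `W = 𝒜 ∩ (R/p, R]`, `Q = ⌊R/p⌋`:
`(Σ_W g x/x − (S_W/H_Q)·Σ_{b≤Q} g b/b)² ≤ 2000·e²⁰·(log R + log 4 + e⁵log(R+1)(log log R + 4))·D_𝒜(g)`. -/
theorem atom_window_law_uniform {p R : ℕ} (hp : 2 ≤ p) (hpR : p ≤ R) (hR : R < p ^ 2) (g : ℕ → ℝ) :
    (∑ x ∈ (Ioc (R / p) R).filter (· ∈ Nat.smoothNumbers p), g x / x -
        (∑ x ∈ (Ioc (R / p) R).filter (· ∈ Nat.smoothNumbers p), 1 / (x : ℝ)) /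
            (∑ b ∈ Icc 1 (R / p), 1 / (b : ℝ)) * ∑ b ∈ Icc 1 (R / p), g b / b) ^ 2 ≤
      2000 * Real.exp 20 *
          (Real.log R + Real.log 4 + Real.exp 5 * Real.log ((R : ℝ) + 1) * (Real.log (Real.log R) + 4)) *
        ∑ x ∈ (Icc 1 R).filter (· ∈ Nat.smoothNumbers p),
          (1 / (x : ℝ)) * ∑ n ∈ x.divisors, (vonMangoldt n : ℝ) * (g x - g (x / n)) ^ 2 := by
  set Q := R / p with hQdef
  set G := Real.log R + Real.log 4 + Real.exp 5 * Real.log ((R : ℝ) + 1) * (Real.log (Real.log R) + 4) with hG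
  set A := (Icc 1 R).filter (· ∈ Nat.smoothNumbers p) with hA
  set Wn := (Ioc Q R).filter (· ∈ Nat.smoothNumbers p) with hWn
  set D := ∑ x ∈ A, (1 / (x : ℝ)) * ∑ n ∈ x.divisors, (vonMangoldt n : ℝ) * (g x - g (x / n)) ^ 2 with hD
  set SW := ∑ x ∈ Wn, 1 / (x : ℝ) with hSW
  set HQ := ∑ b ∈ Icc 1 Q, 1 / (b : ℝ) with hHQ
  have hppos : 0 < p := by omega
  have hRpp : R < p * p := by rw [← pow_two]; exact hR
  have hQ1 : 1 ≤ Q := (Nat.le_div_iff_mul_le hppos).2 (by linarith)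
  have hQp : Q < p := (Nat.div_lt_iff_lt_mul hppos).2 hRpp
  have hQR : Q ≤ R := Nat.div_le_self R p
  have hR2 : 2 ≤ R := le_trans hp hpR
  have hEK0 : 0 ≤ Real.exp 10 * G := EK_nonneg hR2
  have hG0 : 0 ≤ G := (mul_nonneg_iff_of_pos_left (Real.exp_pos 10)).1 hEK0
  have hD0 : 0 ≤ D := Finset.sum_nonneg fun x _ => mul_nonneg (by positivity)
    (Finset.sum_nonneg fun n _ => mul_nonneg ArithmeticFunction.vonMangoldt_nonneg (sq_nonneg _))
  have he5 := Literature.NumberTheory.LFunctions.SiegelZero.HarmFlat.hundred_le_exp_five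
  -- the bottom filter of theoremB's statement is vacuous
  have hB : (Icc 1 Q).filter (· ∈ Nat.smoothNumbers p) = Icc 1 Q :=
    Finset.filter_true_of_mem fun b hb => by
      have := Finset.mem_Icc.1 hb; exact Nat.mem_smoothNumbers_of_lt (by omega) (by omega)
  -- case (a): THEOREM B ∧ K″
  by_cases hTB : 299 ≤ p ∧ 298 * p ≤ R
  · have h := near_extreme_window_law hTB.1 hTB.2 hR g
    unfold exitMassRatioAtom at h
    rw [hB] at h
    exact h
  -- case (b): the K″-atom regime
  by_cases hreg : 2 ≤ Q ∧ 2 * Real.exp 5 * Real.log ((Q : ℕ) : ℝ) + 2 ≤ Real.log R - Real.log ((Q : ℕ) : ℝ)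
  · exact propKK_thin_bottom_atom hreg.1 hRpp hreg.2 g
  -- common sizes
  have hSW0 : 0 ≤ SW := Finset.sum_nonneg fun x _ => by positivity
  have hSWle : SW ≤ 1 + Real.log R := by
    refine le_trans (Finset.sum_le_sum_of_subset_of_nonneg (fun x hx => ?_) fun x _ _ => by positivity)
      (harmonic_Icc_le_one_add_log (R := R) (by omega))
    have := Finset.mem_Ioc.1 (Finset.mem_filter.1 hx).1; exact Finset.mem_Icc.2 ⟨by omega, this.2⟩
  have hHQ1 : 1 ≤ HQ := by
    have : ∑ b ∈ ({1} : Finset ℕ), 1 / (b : ℝ) ≤ HQ :=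
      Finset.sum_le_sum_of_subset_of_nonneg (by
        intro b hb; rw [Finset.mem_singleton] at hb; subst hb; exact Finset.mem_Icc.2 ⟨le_rfl, hQ1⟩)
        fun b _ _ => by positivity
    simpa using this
  rcases Nat.lt_or_ge Q 2 with hQlt | hQ2
  · -- case (c1): Q = 1, the window functional is a root functional inside the atom
    have hQeq : Q = 1 := by omega
    have hW : ∑ x ∈ Wn, g x / x - SW / HQ * ∑ b ∈ Icc 1 Q, g b / b =
        ∑ x ∈ Wn, (1 / (x : ℝ)) * (g x - g 1) := by
      have h1 : HQ = 1 := by simp [hHQ, hQeq]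
      rw [h1, hQeq]; simp only [Finset.Icc_self, Finset.sum_singleton, Nat.cast_one, div_one]
      rw [hSW, Finset.sum_mul, ← Finset.sum_sub_distrib]
      exact Finset.sum_congr rfl fun x _ => by ring
    rw [hW]
    have h := subset_root_functional_sq_le_smooth hR2 p (S := Wn) (fun x hx => by
      have hx' := Finset.mem_filter.1 hx
      have := Finset.mem_Ioc.1 hx'.1
      exact Finset.mem_filter.2 ⟨Finset.mem_Icc.2 ⟨by omega, this.2⟩, hx'.2⟩) g
    refine h.trans ?_
    have h10 : (1 : ℝ) ≤ Real.exp 10 := Real.one_le_exp (by norm_num)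
    have e20 : Real.exp 20 = Real.exp 10 * Real.exp 10 := by rw [← Real.exp_add]; norm_num
    rw [e20]
    have : Real.exp 10 * G ≤ 2000 * (Real.exp 10 * Real.exp 10) * G := by nlinarith
    exact mul_le_mul_of_nonneg_right this hD0
  -- case (c2): 2 ≤ Q, neither (a) nor (b): trivial law, log R bounded
  have htriv := window_law_trivial_smooth (N := p) hQ1 hQR hR2 hQp g
  refine htriv.trans ?_
  have hnreg : Real.log R - Real.log Q < 2 * Real.exp 5 * Real.log Q + 2 := by
    by_contra h; exact hreg ⟨hQ2, not_lt.1 h⟩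
  have hlQ0 : 0 ≤ Real.log Q := Real.log_natCast_nonneg Q
  have hc0 : 0 ≤ SW / HQ := div_nonneg hSW0 (by linarith)
  have hc : SW / HQ ≤ 13 * Real.exp 5 := by
    rw [div_le_iff₀ (by linarith)]
    -- log R ≤ 12e⁵ + 8 in both sub-cases
    have hL : Real.log R ≤ 12 * Real.exp 5 + 8 := by
      rcases Nat.lt_or_ge p 299 with hps | hpb
      · -- p ≤ 298: R < p² ≤ 298², log R ≤ 2·6
        have hR' : R ≤ 298 * 298 := by nlinarith
        have hRr : (R : ℝ) ≤ 298 * 298 := by exact_mod_cast hR'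
        have h298 : Real.log (298 : ℕ) ≤ 6 := log_le_six_of_le (by norm_num) (by norm_num)
        have : Real.log R ≤ Real.log ((298 : ℝ) * 298) :=
          Real.log_le_log (by exact_mod_cast (show 0 < R by omega)) hRr
        rw [Real.log_mul (by norm_num) (by norm_num)] at this
        push_cast at h298
        linarith
      · -- p ≥ 299 but R < 298p: Q ≤ 297, log Q ≤ 6, and log R < (2e⁵+1) log Q + 2
        have hRs : R < 298 * p := by
          by_contra h; exact hTB ⟨hpb, not_lt.1 h⟩
        have hQs : Q ≤ 297 := by
          have : Q < 298 := (Nat.div_lt_iff_lt_mul hppos).2 (by linarith)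
          omega
        have hlQ : Real.log Q ≤ 6 := log_le_six_of_le hQ1 (by omega)
        nlinarith
    nlinarith
  have := trivial_coef_total_le hc0 hc hG0
  exact mul_le_mul_of_nonneg_right this hD0

/-! ### κ-normalised form on `Ω_R` -/

/-- The energy profile against the harmonic normalisation: for `R ≥ 2`,
`log R·G(R) ≤ H_R²·(2 + 2e⁵(log log R + 4))·(1/log 2 + 1)`-type bound, in the usable form
`G(R) ≤ (3 + 2e⁵(log log R + 4))·log R`. -/
theorem energyProfile_le_mul_log {R : ℕ} (hR : 2 ≤ R) :
    Real.log R + Real.log 4 + Real.exp 5 * Real.log ((R : ℝ) + 1) * (Real.log (Real.log R) + 4) ≤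
      (3 + 2 * Real.exp 5 * (Real.log (Real.log R) + 4)) * Real.log R := by
  have hR2 : (2 : ℝ) ≤ R := by exact_mod_cast hR
  have hl2 : (1 : ℝ) / 2 < Real.log 2 := by linarith [Real.log_two_gt_d9]
  have hL : Real.log 2 ≤ Real.log R := Real.log_le_log (by norm_num) hR2
  have hL0 : 0 < Real.log R := by linarith
  -- log 4 = 2 log 2 ≤ 2 log R ; log(R+1) ≤ log(2R) = log 2 + log R ≤ 2 log R
  have h4 : Real.log 4 ≤ 2 * Real.log R := by
    have : Real.log 4 = 2 * Real.log 2 := by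
      rw [show (4 : ℝ) = 2 ^ 2 by norm_num, Real.log_pow]; norm_num
    linarith
  have hR1 : Real.log ((R : ℝ) + 1) ≤ 2 * Real.log R := by
    have : Real.log ((R : ℝ) + 1) ≤ Real.log (2 * R) := Real.log_le_log (by linarith) (by linarith)
    rw [Real.log_mul (by norm_num) (by linarith)] at this
    linarith
  have hll := loglog_add_four_nonneg hR
  have : Real.exp 5 * Real.log ((R : ℝ) + 1) * (Real.log (Real.log R) + 4) ≤
      Real.exp 5 * (2 * Real.log R) * (Real.log (Real.log R) + 4) :=
    mul_le_mul_of_nonneg_right (mul_le_mul_of_nonneg_left hR1 (Real.exp_pos 5).le) hll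
  nlinarith [Real.exp_pos 5]

/-- **κ-proxy form of the uniform law on `Ω_R`** (CONTINUUM-LIMIT 27.1: κ ≤ (H_Q·log R/H_R²)·WF²/D).  For
`1 ≤ Q ≤ R`, `2 ≤ R`, all `g`:
`H_Q·log R·WF² ≤ 2000·e²⁰·(3 + 2e⁵(log log R + 4))·(1 + log Q)·H_R²·D_{Ω_R}(g)`
(`H_Q ≤ 1 + log Q`, `G(R) ≤ (3 + 2e⁵(log log R+4))·log R`, `log R ≤ H_R`… in fact `log R·log R ≤ H_R²` is not
needed: one `log R` cancels against `G(R)/log R` and the other is kept) — i.e. κ(Ω_R; Q) = O((1 + log Q)·log log R). -/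
theorem window_law_uniform_kappa {Q R : ℕ} (hQ : 1 ≤ Q) (hQR : Q ≤ R) (hR : 2 ≤ R) (g : ℕ → ℝ) :
    (∑ b ∈ Icc 1 Q, 1 / (b : ℝ)) *
        (∑ x ∈ Ioc Q R, g x / x -
          (∑ x ∈ Ioc Q R, 1 / (x : ℝ)) / (∑ b ∈ Icc 1 Q, 1 / (b : ℝ)) * ∑ b ∈ Icc 1 Q, g b / b) ^ 2 ≤
      2000 * Real.exp 20 * ((3 + 2 * Real.exp 5 * (Real.log (Real.log R) + 4)) * Real.log R) * (1 + Real.log Q) *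
        ∑ x ∈ Icc 1 R, (1 / (x : ℝ)) * ∑ n ∈ x.divisors, (vonMangoldt n : ℝ) * (g x - g (x / n)) ^ 2 := by
  have h := window_law_uniform hQ hQR hR g
  have hHQ : ∑ b ∈ Icc 1 Q, 1 / (b : ℝ) ≤ 1 + Real.log Q := harmonic_Icc_le_one_add_log (R := Q) hQ
  have hHQ0 : 0 ≤ ∑ b ∈ Icc 1 Q, 1 / (b : ℝ) := Finset.sum_nonneg fun b _ => by positivity
  have hG := energyProfile_le_mul_log hR
  have hD0 : 0 ≤ ∑ x ∈ Icc 1 R, (1 / (x : ℝ)) * ∑ n ∈ x.divisors, (vonMangoldt n : ℝ) * (g x - g (x / n)) ^ 2 :=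
    Finset.sum_nonneg fun x _ => mul_nonneg (by positivity)
      (Finset.sum_nonneg fun n _ => mul_nonneg ArithmeticFunction.vonMangoldt_nonneg (sq_nonneg _))
  have hsq0 : 0 ≤ (∑ x ∈ Ioc Q R, g x / x -
      (∑ x ∈ Ioc Q R, 1 / (x : ℝ)) / (∑ b ∈ Icc 1 Q, 1 / (b : ℝ)) * ∑ b ∈ Icc 1 Q, g b / b) ^ 2 := sq_nonneg _
  have hE : 0 ≤ 2000 * Real.exp 20 := by positivity
  -- H_Q · WF² ≤ (1 + log Q) · 2000e²⁰ G D ≤ (1 + log Q) · 2000e²⁰ (3 + …) log R · D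
  have h1 := mul_le_mul hHQ h hsq0 (by linarith)
  have h2 : 2000 * Real.exp 20 *
      (Real.log R + Real.log 4 + Real.exp 5 * Real.log ((R : ℝ) + 1) * (Real.log (Real.log R) + 4)) *
        ∑ x ∈ Icc 1 R, (1 / (x : ℝ)) * ∑ n ∈ x.divisors, (vonMangoldt n : ℝ) * (g x - g (x / n)) ^ 2 ≤
      2000 * Real.exp 20 * ((3 + 2 * Real.exp 5 * (Real.log (Real.log R) + 4)) * Real.log R) *
        ∑ x ∈ Icc 1 R, (1 / (x : ℝ)) * ∑ n ∈ x.divisors, (vonMangoldt n : ℝ) * (g x - g (x / n)) ^ 2 :=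
    mul_le_mul_of_nonneg_right (mul_le_mul_of_nonneg_left hG hE) hD0
  have hlQ : 0 ≤ 1 + Real.log Q := by have := Real.log_natCast_nonneg Q; linarith
  calc _ ≤ (1 + Real.log Q) * (2000 * Real.exp 20 *
          (Real.log R + Real.log 4 + Real.exp 5 * Real.log ((R : ℝ) + 1) * (Real.log (Real.log R) + 4)) *
        ∑ x ∈ Icc 1 R, (1 / (x : ℝ)) * ∑ n ∈ x.divisors, (vonMangoldt n : ℝ) * (g x - g (x / n)) ^ 2) := h1
    _ ≤ (1 + Real.log Q) * (2000 * Real.exp 20 * ((3 + 2 * Real.exp 5 * (Real.log (Real.log R) + 4)) * Real.log R) *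
        ∑ x ∈ Icc 1 R, (1 / (x : ℝ)) * ∑ n ∈ x.divisors, (vonMangoldt n : ℝ) * (g x - g (x / n)) ^ 2) :=
        mul_le_mul_of_nonneg_left h2 hlQ
    _ = _ := by ring

end Summit.RiemannHypothesis.RiemannHypothesis.Theorems.IntegerScrew

end
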